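/-
Copyright (c) 2026. All rights reserved.
Released under Apache 2.0 license as described in the file LICENSE.
Authors: abc-iut cell, seat abc-iut-w5-d226 (gen 3; consumer plumbing for GAP G-w5d226-2 «G-P13-GR»).
-/
import Literature.AnabelianGeometry.SemiGraphs.PSCCoveringMapAlong
import Literature.AnabelianGeometry.SemiGraphs.ProSigmaSubquotients
import HarnessLib

/-!
# [CombGC] Def 1.1 (ii) / Prop 1.2: transport of a PSC datum along an ISOMORPHISM of topological groups

Mochizuki, *A combinatorial version of the Grothendieck conjecture* [CombGC] (bib `MochizukiCombGC2007`),
Def 1.1 (ii) pp. 6–7 (the PSC-fundamental group `Π_G` with its verticial / edge-like subgroups "determined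
up to conjugation"), Prop 1.2 (i)/(ii) p. 8.

Layer L3's `PSCDatum.mapAlong` (abc-iut-L3-t4, `PSCCoveringMapAlong.lean`) pushes a PSC datum forward
along a continuous homomorphism `f : Π_G → Q` onto a pro-`S` group.  For `f` an ISOMORPHISM of topological
groups (`e : P ≃ₜ* Q`, `S = Σ`) this is TRANSPORT OF STRUCTURE, and every [CombGC] §1 predicate is
invariant.  This PROOF-ONLY file (no definitions) records the invariance of the two Prop 1.2 predicates
consumed by abc-iut-L4's [AbsTopII] Prop 1.3 bridge (`AbsTopII/DPSCDataOfSemiGraph*.lean`):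

* (the `hQ` argument of `mapAlong` is the tree's `IsProSigma.of_continuousMulEquiv`,
  `ProSigmaSubquotients.lean`: `G.proSigma.of_continuousMulEquiv e` for `S = Σ`);
* `Subgroup.Commensurable.commensurator_map_equiv` — `C(e(H)) = e(C(H))`; hence
  `verticialEdgeLikeCommensurablyTerminal_mapAlong_equiv_iff` (Prop 1.2 (ii));
* `isOpen_inf_subgroupOf_map_equiv_iff` — "`A₁ ∩ A₂` open in `A₁`" transports along `e`; hence
  `verticialOpenInterDeterminesVertex_mapAlong_equiv_iff`, `edgeLikeOpenInterDeterminesEdge_mapAlong_equiv_iff`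
  (Prop 1.2 (i)).

Use (GAP G-w5d226-2): when `Π_H := Π_𝒢 ⋊^out H` is CONSTRUCTED as a profinite group (abc-iut-w5-d151 /
L3-d5), `Π_𝒢` sits in it through a closed embedding `ι` with range `Π_𝔾`, and the L4 bridge's PSC datum
on `↥Π_𝔾` is `G.mapAlong` along `ι : Π_𝒢 ≃ₜ* Π_𝔾`; the present lemmas return its [CombGC] Prop 1.2
hypotheses to statements about `G` itself.  Nothing here bears on [IUTchIII] Cor. 3.12.
-/

noncomputable section

namespace Literature.AnabelianGeometry.SemiGraphs

open scoped Pointwise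

universe u

/-! ## §A. Generic transport lemmas -/

section Generic

variable {P : Type u} [Group P] [TopologicalSpace P] {Q : Type u} [Group Q] [TopologicalSpace Q]

omit [TopologicalSpace P] [TopologicalSpace Q] in
/-- Commensurability is invariant under injective homomorphisms (both relative indices are).
[cite: MochizukiCombGC2007, Prop 1.2(ii) p.8] -/
theorem Subgroup.Commensurable.map_iff_of_injective {f : P →* Q} (hf : Function.Injective f)
    (H K : Subgroup P) : Subgroup.Commensurable (H.map f) (K.map f) ↔ Subgroup.Commensurable H K := by
  simp only [Subgroup.Commensurable, Subgroup.relIndex_map_map_of_injective _ _ hf]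

omit [TopologicalSpace P] [TopologicalSpace Q] in
/-- **Commensurators transport along isomorphisms**: `C_{Q}(e(H)) = e(C_{P}(H))` ([CombGC] §0 p. 3
"commensurator"; Prop 1.2 (ii)). [cite: MochizukiCombGC2007, Prop 1.2(ii) p.8] -/
theorem Subgroup.Commensurable.commensurator_map_equiv (e : P ≃* Q) (H : Subgroup P) :
    Subgroup.Commensurable.commensurator (H.map e.toMonoidHom) =
      (Subgroup.Commensurable.commensurator H).map e.toMonoidHom := by
  ext q
  obtain ⟨p, rfl⟩ := e.surjective q
  rw [Subgroup.Commensurable.commensurator_mem_iff, Subgroup.mem_map]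
  have hconj : ConjAct.toConjAct (e p) • H.map e.toMonoidHom =
      (ConjAct.toConjAct p • H).map e.toMonoidHom := by
    rw [PSCDatum.map_conj_smul]; rfl
  rw [hconj, Subgroup.Commensurable.map_iff_of_injective e.injective,
    ← Subgroup.Commensurable.commensurator_mem_iff]
  constructor
  · exact fun h => ⟨p, h, rfl⟩
  · rintro ⟨p', hp', hpp'⟩
    rwa [← e.injective hpp']

/-- The restriction of an isomorphism of topological groups to a subgroup and its image, as a
homeomorphism. [cite: MochizukiCombGC2007, Def 1.1(ii) p.6] -/
theorem exists_homeomorph_subgroup_map (e : P ≃ₜ* Q) (A : Subgroup P) :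
    ∃ h : ↥A ≃ₜ ↥(A.map e.toMulEquiv.toMonoidHom), ∀ x : ↥A, ((h x : ↥(A.map e.toMulEquiv.toMonoidHom)) : Q) = e x := by
  have hmem : ∀ x : P, x ∈ A → e x ∈ A.map e.toMulEquiv.toMonoidHom := fun x hx =>
    Subgroup.mem_map_of_mem _ hx
  have hmem' : ∀ y : Q, y ∈ A.map e.toMulEquiv.toMonoidHom → e.symm y ∈ A := by
    rintro y ⟨x, hx, rfl⟩
    change e.symm (e x) ∈ A
    rw [e.symm_apply_apply]
    exact hx
  refine ⟨{ toFun := fun x => ⟨e x, hmem x x.2⟩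
            invFun := fun y => ⟨e.symm y, hmem' y y.2⟩
            left_inv := fun x => by ext; simp
            right_inv := fun y => by ext; simp
            continuous_toFun := (e.continuous.comp continuous_subtype_val).subtype_mk _
            continuous_invFun := (e.symm.continuous.comp continuous_subtype_val).subtype_mk _ }, fun x => rfl⟩

/-- **"`A₁ ∩ A₂` is open in `A₁`" transports along isomorphisms of topological groups** (the hypothesis
shape of [CombGC] Prop 1.2 (i)). [cite: MochizukiCombGC2007, Prop 1.2(i) p.8] -/
theorem isOpen_inf_subgroupOf_map_equiv_iff (e : P ≃ₜ* Q) (A B : Subgroup P) :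
    IsOpen ((((A.map e.toMulEquiv.toMonoidHom) ⊓ (B.map e.toMulEquiv.toMonoidHom)).subgroupOf
        (A.map e.toMulEquiv.toMonoidHom) : Subgroup ↥(A.map e.toMulEquiv.toMonoidHom)) :
        Set ↥(A.map e.toMulEquiv.toMonoidHom)) ↔
      IsOpen (((A ⊓ B).subgroupOf A : Subgroup ↥A) : Set ↥A) := by
  obtain ⟨h, hh⟩ := exists_homeomorph_subgroup_map e A
  have hpre : h ⁻¹' ((((A.map e.toMulEquiv.toMonoidHom) ⊓ (B.map e.toMulEquiv.toMonoidHom)).subgroupOf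
        (A.map e.toMulEquiv.toMonoidHom) : Subgroup ↥(A.map e.toMulEquiv.toMonoidHom)) : Set _) =
      (((A ⊓ B).subgroupOf A : Subgroup ↥A) : Set ↥A) := by
    ext x
    simp only [Set.mem_preimage, SetLike.mem_coe, Subgroup.mem_subgroupOf, Subgroup.mem_inf, hh]
    constructor
    · rintro ⟨-, hB⟩
      obtain ⟨y, hy, hyx⟩ := Subgroup.mem_map.mp hB
      have : y = (x : P) := e.injective hyx
      exact ⟨x.2, this ▸ hy⟩
    · rintro ⟨hA, hB⟩
      exact ⟨Subgroup.mem_map_of_mem _ hA, Subgroup.mem_map_of_mem _ hB⟩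
  rw [← hpre, h.isOpen_preimage]

omit [TopologicalSpace P] in
/-- The predicate "`A ∩ B` is open in `A`" only depends on the subgroups `A`, `B` (rewriting under the
dependent type `↥A`). [cite: MochizukiCombGC2007, Prop 1.2(i) p.8] -/
theorem isOpen_inf_subgroupOf_congr {A A' B B' : Subgroup Q} (hA : A = A') (hB : B = B') :
    IsOpen (((A ⊓ B).subgroupOf A : Subgroup ↥A) : Set ↥A) ↔
      IsOpen (((A' ⊓ B').subgroupOf A' : Subgroup ↥A') : Set ↥A') := by
  subst hA; subst hB; exact Iff.rfl

end Generic

/-! ## §B. [CombGC] Prop 1.2 predicates of the transported datum `G.mapAlong e` -/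

namespace PSCDatum

variable {P : Type u} [Group P] [TopologicalSpace P] {Q : Type u} [Group Q] [TopologicalSpace Q]
  [CompactSpace P] [T2Space Q] (G : PSCDatum P) (e : P ≃ₜ* Q)
  (S : Set ℕ) (hS : S ⊆ G.Sigma) (hne : S.Nonempty) (hQ : IsProSigma S Q)

/-- The edge-like representatives of the transported datum are the images. [cite: MochizukiCombGC2007, Def 1.1(ii) p.7] -/
theorem mapAlong_edgeGp (x : G.graph.N ⊕ G.graph.C) :
    (G.mapAlong e.toMulEquiv.toMonoidHom e.continuous S hS hne hQ).edgeGp x =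
      (G.edgeGp x).map e.toMulEquiv.toMonoidHom := by
  cases x <;> rfl

/-- **[CombGC] Prop 1.2 (ii) is invariant under transport of the PSC datum along an isomorphism of
topological groups.** [cite: MochizukiCombGC2007, Prop 1.2(ii) p.8] -/
theorem verticialEdgeLikeCommensurablyTerminal_mapAlong_equiv_iff :
    (G.mapAlong e.toMulEquiv.toMonoidHom e.continuous S hS hne hQ).VerticialEdgeLikeCommensurablyTerminal ↔
      G.VerticialEdgeLikeCommensurablyTerminal := by
  have hs : Function.Surjective e.toMulEquiv.toMonoidHom := e.surjective
  have hinj : Function.Injective e.toMulEquiv.toMonoidHom := e.injective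
  constructor
  · intro h A hA
    have hA' : (G.mapAlong e.toMulEquiv.toMonoidHom e.continuous S hS hne hQ).IsVerticial
          (A.map e.toMulEquiv.toMonoidHom) ∨
        (G.mapAlong e.toMulEquiv.toMonoidHom e.continuous S hS hne hQ).IsEdgeLike
          (A.map e.toMulEquiv.toMonoidHom) := by
      rcases hA with hA | hA
      · exact Or.inl ((G.isVerticial_mapAlong_iff _ _ S hS hne hQ hs _).mpr ⟨A, hA, rfl⟩)
      · exact Or.inr ((G.isEdgeLike_mapAlong_iff _ _ S hS hne hQ hs _).mpr ⟨A, hA, rfl⟩)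
    have h1 := h _ hA'
    rw [Subgroup.Commensurable.commensurator_map_equiv] at h1
    exact Subgroup.map_injective hinj h1
  · intro h A' hA'
    have hB : ∃ B, (G.IsVerticial B ∨ G.IsEdgeLike B) ∧ A' = B.map e.toMulEquiv.toMonoidHom := by
      rcases hA' with hA' | hA'
      · obtain ⟨B, hB, rfl⟩ := (G.isVerticial_mapAlong_iff _ _ S hS hne hQ hs _).mp hA'
        exact ⟨B, Or.inl hB, rfl⟩
      · obtain ⟨B, hB, rfl⟩ := (G.isEdgeLike_mapAlong_iff _ _ S hS hne hQ hs _).mp hA'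
        exact ⟨B, Or.inr hB, rfl⟩
    obtain ⟨B, hB, rfl⟩ := hB
    rw [Subgroup.Commensurable.commensurator_map_equiv, h B hB]

/-- **[CombGC] Prop 1.2 (i), verticial case, is invariant under transport along an isomorphism of
topological groups.** [cite: MochizukiCombGC2007, Prop 1.2(i) p.8] -/
theorem verticialOpenInterDeterminesVertex_mapAlong_equiv_iff :
    (G.mapAlong e.toMulEquiv.toMonoidHom e.continuous S hS hne hQ).VerticialOpenInterDeterminesVertex ↔
      G.VerticialOpenInterDeterminesVertex := by
  have hs : Function.Surjective e.toMulEquiv.toMonoidHom := e.surjective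
  constructor
  · intro h v₁ v₂ γ₁ γ₂ hopen
    refine h v₁ v₂ (ConjAct.toConjAct (e.toMulEquiv.toMonoidHom (ConjAct.ofConjAct γ₁)))
      (ConjAct.toConjAct (e.toMulEquiv.toMonoidHom (ConjAct.ofConjAct γ₂))) ?_
    exact (isOpen_inf_subgroupOf_congr (map_conj_smul e.toMulEquiv.toMonoidHom γ₁ (G.vertGp v₁))
      (map_conj_smul e.toMulEquiv.toMonoidHom γ₂ (G.vertGp v₂))).mp
      ((isOpen_inf_subgroupOf_map_equiv_iff e _ _).mpr hopen)
  · intro h v₁ v₂ γ₁' γ₂' hopen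
    obtain ⟨γ₁, h₁⟩ := exists_smul_map_eq (f := e.toMulEquiv.toMonoidHom) hs γ₁' (G.vertGp v₁)
    obtain ⟨γ₂, h₂⟩ := exists_smul_map_eq (f := e.toMulEquiv.toMonoidHom) hs γ₂' (G.vertGp v₂)
    refine h v₁ v₂ γ₁ γ₂ ?_
    exact (isOpen_inf_subgroupOf_map_equiv_iff e _ _).mp ((isOpen_inf_subgroupOf_congr h₁ h₂).mp hopen)

/-- **[CombGC] Prop 1.2 (i), edge-like case, is invariant under transport along an isomorphism of
topological groups.** [cite: MochizukiCombGC2007, Prop 1.2(i) p.8] -/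
theorem edgeLikeOpenInterDeterminesEdge_mapAlong_equiv_iff :
    (G.mapAlong e.toMulEquiv.toMonoidHom e.continuous S hS hne hQ).EdgeLikeOpenInterDeterminesEdge ↔
      G.EdgeLikeOpenInterDeterminesEdge := by
  have hs : Function.Surjective e.toMulEquiv.toMonoidHom := e.surjective
  constructor
  · intro h x₁ x₂ γ₁ γ₂ hopen
    refine h x₁ x₂ (ConjAct.toConjAct (e.toMulEquiv.toMonoidHom (ConjAct.ofConjAct γ₁)))
      (ConjAct.toConjAct (e.toMulEquiv.toMonoidHom (ConjAct.ofConjAct γ₂))) ?_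
    rw [mapAlong_edgeGp, mapAlong_edgeGp]
    exact (isOpen_inf_subgroupOf_congr (map_conj_smul e.toMulEquiv.toMonoidHom γ₁ (G.edgeGp x₁))
      (map_conj_smul e.toMulEquiv.toMonoidHom γ₂ (G.edgeGp x₂))).mp
      ((isOpen_inf_subgroupOf_map_equiv_iff e _ _).mpr hopen)
  · intro h x₁ x₂ γ₁' γ₂' hopen
    obtain ⟨γ₁, h₁⟩ := exists_smul_map_eq (f := e.toMulEquiv.toMonoidHom) hs γ₁' (G.edgeGp x₁)
    obtain ⟨γ₂, h₂⟩ := exists_smul_map_eq (f := e.toMulEquiv.toMonoidHom) hs γ₂' (G.edgeGp x₂)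
    refine h x₁ x₂ γ₁ γ₂ ?_
    rw [mapAlong_edgeGp, mapAlong_edgeGp] at hopen
    exact (isOpen_inf_subgroupOf_map_equiv_iff e _ _).mp ((isOpen_inf_subgroupOf_congr h₁ h₂).mp hopen)

end PSCDatum

end Literature.AnabelianGeometry.SemiGraphs
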